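import Literature.Analysis.FluidPDE.WaveKineticCollisionBounds
import Mathlib.Topology.ContinuousMap.Bounded.Normed
import Mathlib.Topology.MetricSpace.Contracting
import Mathlib.Analysis.ODE.PicardLindelof
import HarnessLib

/-!
# Local well-posedness of the cubic wave kinetic equation

This file discharges the named fact `WaveKinetic.exists_isWKESolutionOn_local` of
`Literature.Analysis.FluidPDE.WaveKinetic`: for Schwartz initial data `n_in` on a Euclidean space
`E` of dimension `≥ 3` there is `T > 0` and a classical solution `n` of the wave kinetic equation
`∂ₜ n = 𝒦(n)` on `[0, T)` with `n(0) = n_in`, continuous in time at every wave number, with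
absolutely convergent collision integrals (`WKEIntegrable`) and uniform polynomial decay of every
order (`HasUniformDecayOn T s n` for all `s`).

## Proof

This is the weighted-`L^∞` fixed-point argument of Germain–Ionescu–Tran (J. Funct. Anal. 279
(2020) 108570, Thm 2.1 with Prop 2.3; d = 3 there, Rem 2.6 for general `d ≥ 2`), run in the
non-optimal class `|n(k)| ≤ N (1 + ‖k‖)^{-2σ}`, `σ = dim E + 1`, using the collision bounds of
`Literature.Analysis.FluidPDE.WaveKineticCollisionBounds`:

* `continuous_collision`: `k ↦ 𝒦(n)(k)` is continuous for continuous decaying `n` (two nested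
  dominated-convergence arguments), so the problem lives in bounded continuous functions;
* `exists_vectorField`: `f ↦ w₀⁻¹ 𝒦(w₀ f)` is a self-map of `E →ᵇ ℝ` (`w₀ = (1 + ‖·‖)^{-2σ}`),
  cubic growth and Lipschitz on balls by the tame and Lipschitz bounds;
* `exists_picard_fixedPoint`: Banach's fixed point theorem for the Picard map on a closed,
  invariant set of curves `[0, T] → X` (abstract, any Banach space `X`);
* `exists_isWKESolutionOn_local_holds`: the invariant set is cut out by the a priori bounds
  `‖f(t)‖ ≤ R` and, for every `s ≥ 2σ` simultaneously, `|n(t, k)| ≤ B_s e^{c_s t} (1 + ‖k‖)^{-s}`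
  (`B_s` from Schwartz seminorms of `n_in`, `c_s = A 2^s R²` from the tame bound); invariance of
  the latter under the Picard map is the persistence-of-decay mechanism that yields decay of all
  orders on a common time interval. The fixed point is differentiated with
  `ODE.hasDerivWithinAt_picard_Icc` and evaluated pointwise in `k`.

No new definitions are introduced.

## References

* P. Germain, A. D. Ionescu, M.-B. Tran, *Optimal local well-posedness theory for the kinetic
  wave equation*, J. Funct. Anal. 279 (2020) 108570 [GermainIonescuTran2020], Thm 2.1,
  Prop 2.3, Rem 2.6, §5.
* Y. Deng, Z. Hani, *Full derivation of the wave kinetic equation*, J. Amer. Math. Soc. 36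
  (2023), Thm 1.1 (where local existence of the WKE solution is quoted).
-/

open MeasureTheory Set Filter Topology Metric
open scoped InnerProductSpace ENNReal NNReal BoundedContinuousFunction Interval

namespace Literature.Analysis.FluidPDE

noncomputable section

namespace WaveKinetic

section Continuity

variable {E : Type*} [NormedAddCommGroup E] [InnerProductSpace ℝ E] [FiniteDimensional ℝ E]
  [MeasurableSpace E] [BorelSpace E]

omit [InnerProductSpace ℝ E] [FiniteDimensional ℝ E] [MeasurableSpace E] [BorelSpace E] in
/-- Continuity in the wave number `k` of the resonant cubic integrand, for continuous `n`.
[folklore] -/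
theorem continuous_cubicForm_param {n : E → ℝ} (hn : Continuous n) (a b : E) :
    Continuous fun k : E => cubicForm n k (k + a) (k + a + b) (k + b) := by
  unfold cubicForm; fun_prop

/-- **Continuity of the collision operator's output.** If `n` is continuous with
`|n| ≤ N (1 + ‖·‖)^{-2σ}`, `σ > dim E`, `dim E ≥ 2`, then `k ↦ 𝒦(n)(k)` is continuous (two nested
dominated-convergence arguments; this is why Germain–Ionescu–Tran's `L^∞_s` consists of
continuous functions). [cite: GermainIonescuTran2020, Prop 2.3] -/
theorem continuous_collision {σ : ℝ} (hσ : (Module.finrank ℝ E : ℝ) < σ)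
    (hE : 2 ≤ Module.finrank ℝ E) {n : E → ℝ} (hn : Continuous n) {N : ℝ} (hN : 0 ≤ N)
    (hdec : ∀ x, |n x| ≤ N * (1 + ‖x‖) ^ (-(2 * σ))) :
    Continuous fun k : E => collision n k := by
  have hσ0 : 0 ≤ σ := le_trans (Nat.cast_nonneg _) hσ.le
  have h2σ : 0 ≤ 2 * σ := by positivity
  have hnm : Measurable n := hn.measurable
  obtain ⟨C, hC0, hC⟩ := exists_subspace_integral_le (E := E) hσ
  obtain ⟨M, hM⟩ := exists_outer_integral_le (E := E) hσ hE
  obtain ⟨A₁, A, hA₁, hA, hcore⟩ := exists_core_bound (E := E) hσ hE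
  set Kb : ℝ := 4 * (2 : ℝ) ^ (2 * σ) * (N * (N * N + N * N)) with hKb
  have hKb0 : 0 ≤ Kb := by positivity
  have hdom : ∀ k a b : E, ⟪a, b⟫_ℝ = 0 → |cubicForm n k (k + a) (k + a + b) (k + b)| ≤
      (Kb * (1 + ‖k‖) ^ (-(2 * σ))) *
        ((1 + ‖k + a + b‖) ^ (-(2 * σ)) * (1 + ‖k + b‖) ^ (-(2 * σ))
          + (1 + ‖k + a‖) ^ (-(2 * σ)) * (1 + ‖k + b‖) ^ (-(2 * σ))
          + (1 + ‖k + a‖) ^ (-(2 * σ)) * (1 + ‖k + a + b‖) ^ (-(2 * σ))) := by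
    intro k a b hab
    have := cubic_dom (s₀ := 2 * σ) (s' := 2 * σ) (p := n) (q := n) (r := n) h2σ
      hN hN hN hN hN hdec hdec hdec hdec hdec k a b hab
    calc _ ≤ _ := this
      _ = _ := by simp only [hKb]; ring
  have hk : ∀ k : E, _ := fun k =>
    hcore (fun a b => cubicForm n k (k + a) (k + a + b) (k + b)) (Kb * (1 + ‖k‖) ^ (-(2 * σ)))
      k (by positivity) (measurable_cubicForm_uncurry hnm k) (hdom k)
  rw [continuous_iff_continuousAt]
  intro k₀
  set ρ : ℝ := ‖k₀‖ + 1 with hρ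
  have hρ0 : 0 ≤ ρ := by positivity
  have h1ρ : 1 ≤ (1 + ρ) ^ σ := Real.one_le_rpow (by linarith) hσ0
  have hball : ∀ᶠ k in 𝓝 k₀, ‖k‖ ≤ ρ := by
    filter_upwards [Metric.ball_mem_nhds k₀ one_pos] with k hk
    have h1 : ‖k - k₀‖ < 1 := by rwa [mem_ball, dist_eq_norm] at hk
    calc ‖k‖ = ‖(k - k₀) + k₀‖ := by rw [sub_add_cancel]
      _ ≤ ‖k - k₀‖ + ‖k₀‖ := norm_add_le _ _
      _ ≤ ρ := by simp only [hρ]; linarith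
  have hpk : ∀ k : E, ‖k‖ ≤ ρ → (1 + ‖k‖) ^ σ ≤ (1 + ρ) ^ σ := fun k hk =>
    Real.rpow_le_rpow (by positivity) (by linarith) hσ0
  show ContinuousAt (fun k => ∫ a : E, (2 * ‖a‖)⁻¹ *
    ∫ b : ↥(ℝ ∙ a)ᗮ, cubicForm n k (k + a) (k + a + b) (k + b)) k₀
  apply continuousAt_of_dominated (bound := fun a => Kb * A₁ * (1 + ρ) ^ σ / 2 *
    (‖a‖⁻¹ * (2 * (2 : ℝ) ^ σ * (1 + ‖a‖) ^ (-σ) + (1 + ‖(0 : E) + a‖) ^ (-σ))))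
  · exact Eventually.of_forall fun k => (hk k).2.2.1.aestronglyMeasurable
  · filter_upwards [hball] with k hkρ
    refine Eventually.of_forall fun a => ?_
    have hin := (hk k).2.1 a
    have hwk : (1 + ‖k‖) ^ (-(2 * σ)) ≤ 1 := wt_le_one h2σ k
    have hpe : (1 + ‖k + a‖) ^ (-σ) ≤ (1 + ρ) ^ σ * (1 + ‖(0 : E) + a‖) ^ (-σ) := by
      rw [zero_add, add_comm k a]
      exact (wt_add_le hσ0 a k).trans (mul_le_mul_of_nonneg_right (hpk k hkρ) (wt_pos σ a).le)
    have hh : 2 * (2 : ℝ) ^ σ * (1 + ‖a‖) ^ (-σ) + (1 + ‖k + a‖) ^ (-σ) ≤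
        (1 + ρ) ^ σ * (2 * (2 : ℝ) ^ σ * (1 + ‖a‖) ^ (-σ) + (1 + ‖(0 : E) + a‖) ^ (-σ)) := by
      have : 2 * (2 : ℝ) ^ σ * (1 + ‖a‖) ^ (-σ) ≤ (1 + ρ) ^ σ * (2 * (2 : ℝ) ^ σ * (1 + ‖a‖) ^ (-σ)) :=
        le_mul_of_one_le_left (by positivity) h1ρ
      rw [mul_add]
      linarith
    rw [norm_mul, Real.norm_eq_abs, Real.norm_eq_abs,
      abs_of_nonneg (by positivity : (0 : ℝ) ≤ (2 * ‖a‖)⁻¹)]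
    calc (2 * ‖a‖)⁻¹ * |∫ b : ↥(ℝ ∙ a)ᗮ, cubicForm n k (k + a) (k + a + b) (k + b)|
        ≤ (2 * ‖a‖)⁻¹ * (Kb * (1 + ‖k‖) ^ (-(2 * σ)) * A₁ *
            (2 * (2 : ℝ) ^ σ * (1 + ‖a‖) ^ (-σ) + (1 + ‖k + a‖) ^ (-σ))) := by gcongr
      _ ≤ (2 * ‖a‖)⁻¹ * (Kb * 1 * A₁ * ((1 + ρ) ^ σ *
            (2 * (2 : ℝ) ^ σ * (1 + ‖a‖) ^ (-σ) + (1 + ‖(0 : E) + a‖) ^ (-σ)))) := by gcongr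
      _ = Kb * A₁ * (1 + ρ) ^ σ / 2 *
            (‖a‖⁻¹ * (2 * (2 : ℝ) ^ σ * (1 + ‖a‖) ^ (-σ) + (1 + ‖(0 : E) + a‖) ^ (-σ))) := by
          rw [mul_inv]; ring
  · exact (hM 0).1.const_mul _
  · refine Eventually.of_forall fun a => ?_
    have hIa : ContinuousAt
        (fun k => ∫ b : ↥(ℝ ∙ a)ᗮ, cubicForm n k (k + a) (k + a + b) (k + b)) k₀ := by
      apply continuousAt_of_dominated (bound := fun b : ↥(ℝ ∙ a)ᗮ => Kb * (1 + ρ) ^ σ *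
        (2 * (2 : ℝ) ^ σ * (1 + ‖(0 : E) + (b : E)‖) ^ (-σ) + (1 + ‖a + (b : E)‖) ^ (-σ)))
      · exact Eventually.of_forall fun k => ((hk k).1 a).aestronglyMeasurable
      · filter_upwards [hball] with k hkρ
        refine Eventually.of_forall fun b => ?_
        rw [Real.norm_eq_abs]
        have hab : ⟪a, (b : E)⟫_ℝ = 0 :=
          (Submodule.mem_orthogonal_singleton_iff_inner_right).mp b.2
        have h1 := hdom k a b hab
        have h2 := resonant_weights_le hσ0 k a b hab
        have hwk : (1 + ‖k‖) ^ (-(2 * σ)) ≤ 1 := wt_le_one h2σ k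
        have e1 : (1 + ‖k + (b : E)‖) ^ (-σ) ≤ (1 + ρ) ^ σ * (1 + ‖(0 : E) + b‖) ^ (-σ) := by
          rw [zero_add, add_comm k]
          exact (wt_add_le hσ0 (b : E) k).trans
            (mul_le_mul_of_nonneg_right (hpk k hkρ) (wt_pos _ _).le)
        have e2 : (1 + ‖k + a + (b : E)‖) ^ (-σ) ≤ (1 + ρ) ^ σ * (1 + ‖a + (b : E)‖) ^ (-σ) := by
          rw [show k + a + (b : E) = (a + b) + k by abel]
          exact (wt_add_le hσ0 (a + (b : E)) k).trans
            (mul_le_mul_of_nonneg_right (hpk k hkρ) (wt_pos _ _).le)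
        have f1 : 2 * (2 : ℝ) ^ σ * (1 + ‖a‖) ^ (-σ) * (1 + ‖k + (b : E)‖) ^ (-σ) ≤
            2 * (2 : ℝ) ^ σ * 1 * ((1 + ρ) ^ σ * (1 + ‖(0 : E) + b‖) ^ (-σ)) := by
          gcongr; exact wt_le_one hσ0 a
        have f2 : (1 + ‖k + a‖) ^ (-σ) * (1 + ‖k + a + (b : E)‖) ^ (-σ) ≤
            1 * ((1 + ρ) ^ σ * (1 + ‖a + (b : E)‖) ^ (-σ)) :=
          mul_le_mul (wt_le_one hσ0 _) e2 (wt_pos _ _).le zero_le_one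
        calc |cubicForm n k (k + a) (k + a + b) (k + b)|
            ≤ (Kb * (1 + ‖k‖) ^ (-(2 * σ))) *
              ((1 + ‖k + a + b‖) ^ (-(2 * σ)) * (1 + ‖k + b‖) ^ (-(2 * σ))
                + (1 + ‖k + a‖) ^ (-(2 * σ)) * (1 + ‖k + b‖) ^ (-(2 * σ))
                + (1 + ‖k + a‖) ^ (-(2 * σ)) * (1 + ‖k + a + b‖) ^ (-(2 * σ))) := h1
          _ ≤ (Kb * 1) * (2 * (2 : ℝ) ^ σ * (1 + ‖a‖) ^ (-σ) * (1 + ‖k + (b : E)‖) ^ (-σ)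
                + (1 + ‖k + a‖) ^ (-σ) * (1 + ‖k + a + (b : E)‖) ^ (-σ)) := by gcongr
          _ ≤ (Kb * 1) * (2 * (2 : ℝ) ^ σ * 1 * ((1 + ρ) ^ σ * (1 + ‖(0 : E) + b‖) ^ (-σ))
                + 1 * ((1 + ρ) ^ σ * (1 + ‖a + (b : E)‖) ^ (-σ))) := by gcongr
          _ = Kb * (1 + ρ) ^ σ *
              (2 * (2 : ℝ) ^ σ * (1 + ‖(0 : E) + (b : E)‖) ^ (-σ) + (1 + ‖a + (b : E)‖) ^ (-σ)) := by
              ring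
      · exact (((hC _ 0).1.const_mul (2 * (2 : ℝ) ^ σ)).add (hC _ a).1).const_mul _
      · exact Eventually.of_forall fun b => (continuous_cubicForm_param hn a b).continuousAt
    exact continuousAt_const.mul hIa

end Continuity

section VectorField

variable {E : Type*} [NormedAddCommGroup E] [InnerProductSpace ℝ E] [FiniteDimensional ℝ E]
  [MeasurableSpace E] [BorelSpace E]

omit [InnerProductSpace ℝ E] [FiniteDimensional ℝ E] [MeasurableSpace E] [BorelSpace E] in
/-- The weight `x ↦ (1 + ‖x‖)^{-s}` is continuous. [folklore] -/
theorem continuous_wt (s : ℝ) : Continuous fun x : E => (1 + ‖x‖) ^ (-s) :=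
  Continuous.rpow_const (by fun_prop) fun x => Or.inl (by positivity)

/-- **The wave-kinetic vector field on bounded continuous functions.** With the base weight
`w₀ = (1 + ‖·‖)^{-2σ}` (`σ > dim E`, `dim E ≥ 2`), the map
`f ↦ w₀⁻¹ · 𝒦(w₀ f)` is well defined from `E →ᵇ ℝ` to itself (continuity from
`continuous_collision`, boundedness from the tame bound). [folklore] -/
theorem exists_vectorField {σ : ℝ} (hσ : (Module.finrank ℝ E : ℝ) < σ)
    (hE : 2 ≤ Module.finrank ℝ E) :
    ∃ V : (E →ᵇ ℝ) → (E →ᵇ ℝ), ∀ (f : E →ᵇ ℝ) (k : E),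
      V f k = ((1 + ‖k‖) ^ (-(2 * σ)))⁻¹ *
        collision (fun x => (1 + ‖x‖) ^ (-(2 * σ)) * f x) k := by
  obtain ⟨A, hA0, hA⟩ := exists_collision_tame_bound (E := E) hσ hE
  have hσ0 : 0 ≤ σ := le_trans (Nat.cast_nonneg _) hσ.le
  have h2σ : 0 ≤ 2 * σ := by positivity
  have key : ∀ f : E →ᵇ ℝ,
      Continuous (fun k => ((1 + ‖k‖) ^ (-(2 * σ)))⁻¹ *
        collision (fun x => (1 + ‖x‖) ^ (-(2 * σ)) * f x) k) ∧
      ∀ k, ‖((1 + ‖k‖) ^ (-(2 * σ)))⁻¹ *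
        collision (fun x => (1 + ‖x‖) ^ (-(2 * σ)) * f x) k‖ ≤
          A * 2 ^ (2 * σ) * ‖f‖ ^ 2 * ‖f‖ := by
    intro f
    have hdec : ∀ x, |(1 + ‖x‖) ^ (-(2 * σ)) * f x| ≤ ‖f‖ * (1 + ‖x‖) ^ (-(2 * σ)) := by
      intro x
      rw [abs_mul, abs_of_pos (wt_pos _ x), mul_comm]
      gcongr
      rw [← Real.norm_eq_abs]
      exact f.norm_coe_le_norm x
    have hcont : Continuous fun x => (1 + ‖x‖) ^ (-(2 * σ)) * f x :=
      (continuous_wt (2 * σ)).mul f.continuous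
    constructor
    · exact ((continuous_wt (2 * σ)).inv₀ fun x => (wt_pos _ x).ne').mul
        (continuous_collision hσ hE hcont (norm_nonneg f) hdec)
    · intro k
      have hb := hA _ ‖f‖ ‖f‖ (2 * σ) k hcont.measurable (norm_nonneg _) (norm_nonneg _) h2σ
        hdec hdec
      rw [norm_mul, Real.norm_eq_abs, Real.norm_eq_abs, abs_inv, abs_of_pos (wt_pos _ k)]
      calc ((1 + ‖k‖) ^ (-(2 * σ)))⁻¹ * |collision (fun x => (1 + ‖x‖) ^ (-(2 * σ)) * f x) k|
          ≤ ((1 + ‖k‖) ^ (-(2 * σ)))⁻¹ *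
            (A * 2 ^ (2 * σ) * ‖f‖ ^ 2 * ‖f‖ * (1 + ‖k‖) ^ (-(2 * σ))) := by gcongr
        _ = A * 2 ^ (2 * σ) * ‖f‖ ^ 2 * ‖f‖ := by
            field_simp [(wt_pos (2 * σ) k).ne']
  exact ⟨fun f => BoundedContinuousFunction.ofNormedAddCommGroup _ (key f).1 _ (key f).2,
    fun f k => rfl⟩

end VectorField

section Picard

variable {X : Type*} [NormedAddCommGroup X] [NormedSpace ℝ X] [CompleteSpace X]

/-- **Picard iteration on a closed invariant set of curves.** Let `V : X → X` be continuous and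
`Λ`-Lipschitz on the closed ball of radius `R`, `T Λ ≤ 1/2`, and let `S` be a nonempty closed set
of continuous curves `[0, T] → X` taking values in that ball and invariant under the Picard map
`γ ↦ (t ↦ f₀ + ∫₀ᵗ V(γ))`. Then the Picard map has a fixed point in `S`; it starts at `f₀` and
solves `γ' = V(γ)` on `[0, T]` (Banach fixed point on the complete subset `S`). [folklore] -/
theorem exists_picard_fixedPoint (V : X → X) (f₀ : X) {T R Λ : ℝ} (hT : 0 < T) (hΛ : 0 ≤ Λ)
    (hVc : Continuous V)
    (hV : ∀ f g : X, ‖f‖ ≤ R → ‖g‖ ≤ R → ‖V f - V g‖ ≤ Λ * ‖f - g‖) (hTΛ : T * Λ ≤ 1 / 2)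
    (S : Set (Icc (0 : ℝ) T →ᵇ X)) (hSc : IsClosed S) (hSn : S.Nonempty)
    (hSR : ∀ γ ∈ S, ∀ t, ‖γ t‖ ≤ R)
    (hSP : ∀ γ ∈ S, ∀ γ' : Icc (0 : ℝ) T →ᵇ X,
      (∀ t : Icc (0 : ℝ) T, γ' t = f₀ + ∫ τ in (0 : ℝ)..(t : ℝ), V (γ (projIcc 0 T hT.le τ))) →
        γ' ∈ S) :
    ∃ γ ∈ S, γ (projIcc 0 T hT.le 0) = f₀ ∧
      ∀ t ∈ Icc (0 : ℝ) T, HasDerivWithinAt (fun s => γ (projIcc 0 T hT.le s))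
        (V (γ (projIcc 0 T hT.le t))) (Icc 0 T) t := by
  -- the Picard map
  have hint : ∀ (γ : Icc (0 : ℝ) T →ᵇ X) (a b : ℝ),
      IntervalIntegrable (fun τ => V (γ (projIcc 0 T hT.le τ))) volume a b := fun γ a b =>
    ((hVc.comp (γ.continuous.comp continuous_projIcc)).intervalIntegrable a b)
  have hPc : ∀ γ : Icc (0 : ℝ) T →ᵇ X, Continuous fun t : Icc (0 : ℝ) T =>
      f₀ + ∫ τ in (0 : ℝ)..(t : ℝ), V (γ (projIcc 0 T hT.le τ)) := fun γ =>
    continuous_const.add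
      ((intervalIntegral.continuous_primitive (hint γ) 0).comp continuous_subtype_val)
  set P : (Icc (0 : ℝ) T →ᵇ X) → (Icc (0 : ℝ) T →ᵇ X) := fun γ =>
    BoundedContinuousFunction.mkOfCompact ⟨_, hPc γ⟩ with hP
  have hPapply : ∀ (γ : Icc (0 : ℝ) T →ᵇ X) (t : Icc (0 : ℝ) T),
      P γ t = f₀ + ∫ τ in (0 : ℝ)..(t : ℝ), V (γ (projIcc 0 T hT.le τ)) := fun γ t => rfl
  have hmaps : MapsTo P S S := fun γ hγ => hSP γ hγ (P γ) (hPapply γ)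
  -- contraction on S
  have hlip : ∀ γ₁ ∈ S, ∀ γ₂ ∈ S, dist (P γ₁) (P γ₂) ≤ 1 / 2 * dist γ₁ γ₂ := by
    intro γ₁ h₁ γ₂ h₂
    refine (BoundedContinuousFunction.dist_le (by positivity)).mpr fun t => ?_
    rw [dist_eq_norm, hPapply, hPapply, add_sub_add_left_eq_sub,
      ← intervalIntegral.integral_sub (hint γ₁ _ _) (hint γ₂ _ _)]
    have hb : ∀ τ ∈ Ι (0 : ℝ) t, ‖V (γ₁ (projIcc 0 T hT.le τ)) - V (γ₂ (projIcc 0 T hT.le τ))‖ ≤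
        Λ * dist γ₁ γ₂ := by
      intro τ _
      refine (hV _ _ (hSR γ₁ h₁ _) (hSR γ₂ h₂ _)).trans ?_
      gcongr
      rw [← dist_eq_norm]
      exact BoundedContinuousFunction.dist_coe_le_dist _
    refine (intervalIntegral.norm_integral_le_of_norm_le_const hb).trans ?_
    have ht : |(t : ℝ) - 0| ≤ T := by
      rw [sub_zero, abs_of_nonneg t.2.1]; exact t.2.2
    calc Λ * dist γ₁ γ₂ * |(t : ℝ) - 0| ≤ Λ * dist γ₁ γ₂ * T := by gcongr
      _ = (T * Λ) * dist γ₁ γ₂ := by ring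
      _ ≤ 1 / 2 * dist γ₁ γ₂ := by gcongr
  have hcontr : ContractingWith (1 / 2) (hmaps.restrict P S S) := by
    refine ⟨by norm_num, LipschitzWith.of_dist_le_mul fun γ₁ γ₂ => ?_⟩
    have := hlip γ₁ γ₁.2 γ₂ γ₂.2
    simp only [Subtype.dist_eq, MapsTo.val_restrict_apply, NNReal.coe_div, NNReal.coe_one,
      NNReal.coe_ofNat]
    exact this
  obtain ⟨γ₀, hγ₀⟩ := hSn
  obtain ⟨γ, hγS, hfix, -⟩ := hcontr.exists_fixedPoint' hSc.isComplete hmaps hγ₀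
    (edist_ne_top _ _)
  -- properties of the fixed point
  have hγt : ∀ t : Icc (0 : ℝ) T,
      γ t = f₀ + ∫ τ in (0 : ℝ)..(t : ℝ), V (γ (projIcc 0 T hT.le τ)) := fun t => by
    rw [← hPapply γ t, hfix.eq]
  refine ⟨γ, hγS, ?_, ?_⟩
  · have := hγt (projIcc 0 T hT.le 0)
    rw [projIcc_left] at this ⊢
    simpa using this
  · intro t ht
    have hder := ODE.hasDerivWithinAt_picard_Icc (f := fun (_ : ℝ) (x : X) => V x) (tmin := 0)
      (tmax := T) (t₀ := 0) (u := univ) (α := fun s => γ (projIcc 0 T hT.le s))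
      (left_mem_Icc.mpr hT.le) ((hVc.comp continuous_snd).continuousOn)
      (γ.continuous.comp continuous_projIcc).continuousOn (fun _ _ => mem_univ _) f₀ ht
    refine hder.congr (fun s hs => ?_) ?_
    · rw [ODE.picard_apply, projIcc_of_mem hT.le hs]
      exact hγt ⟨s, hs⟩
    · rw [ODE.picard_apply, projIcc_of_mem hT.le ht]
      exact hγt ⟨t, ht⟩

end Picard

section LocalExistence

variable {E : Type*} [NormedAddCommGroup E] [InnerProductSpace ℝ E] [FiniteDimensional ℝ E]
  [MeasurableSpace E] [BorelSpace E]

omit [InnerProductSpace ℝ E] [FiniteDimensional ℝ E] [MeasurableSpace E] [BorelSpace E] in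
/-- Schwartz functions have finite weighted sup norms `sup_k (1 + ‖k‖)^s |f k|` of every real
order `s ≥ 0`, with a bound depending on `s` through `⌈s⌉` Schwartz seminorms. [folklore] -/
theorem schwartz_weighted_bound [NormedSpace ℝ E] (nin : SchwartzMap E ℝ) :
    ∃ Bf : ℝ → ℝ, ∀ s : ℝ, 0 ≤ s → 0 ≤ Bf s ∧ ∀ k : E, (1 + ‖k‖) ^ s * |nin k| ≤ Bf s := by
  refine ⟨fun s => 2 ^ ⌈s⌉₊ *
    (Finset.Iic (⌈s⌉₊, 0)).sup (fun m => SchwartzMap.seminorm ℝ m.1 m.2) nin, fun s hs => ?_⟩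
  refine ⟨mul_nonneg (by positivity) (apply_nonneg _ _), fun k => ?_⟩
  have h := SchwartzMap.one_add_le_sup_seminorm_apply (𝕜 := ℝ) (m := (⌈s⌉₊, 0)) (k := ⌈s⌉₊)
    (n := 0) le_rfl le_rfl nin k
  rw [norm_iteratedFDeriv_zero] at h
  calc (1 + ‖k‖) ^ s * |nin k| ≤ (1 + ‖k‖) ^ (⌈s⌉₊ : ℝ) * |nin k| :=
        mul_le_mul_of_nonneg_right (Real.rpow_le_rpow_of_exponent_le
          (le_add_of_nonneg_right (norm_nonneg k)) (Nat.le_ceil s)) (abs_nonneg _)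
    _ = (1 + ‖k‖) ^ ⌈s⌉₊ * ‖nin k‖ := by rw [Real.rpow_natCast, Real.norm_eq_abs]
    _ ≤ _ := h

/-- **Local well-posedness of the wave kinetic equation** (discharge of
`WaveKinetic.exists_isWKESolutionOn_local`). For Schwartz initial data in dimension `≥ 3` there is
`T > 0` and a classical solution of `∂ₜ n = 𝒦(n)` on `[0, T)`, continuous in time, with
absolutely convergent collision integrals and uniform polynomial decay of every order.
Proof: Picard iteration for `f = n / w₀`, `w₀ = (1 + ‖·‖)^{-2(d+1)}`, in the Banach space of
bounded continuous functions, on the closed set of curves obeying the a priori tame bounds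
`|n(t,k)| ≤ B_s e^{c_s t} (1 + ‖k‖)^{-s}` for all `s` simultaneously (persistence of decay from the
tame estimate `exists_collision_tame_bound`); this is Germain–Ionescu–Tran's `L^∞_s` fixed-point
argument (their Thm 2.1, d = 3, Rem 2.6 for general d) in a non-optimal weighted class.
[cite: GermainIonescuTran2020, Thm 2.1] -/
theorem exists_isWKESolutionOn_local_holds : exists_isWKESolutionOn_local (E := E) := by
  intro hE3 nin _hnonneg
  have hE2 : 2 ≤ Module.finrank ℝ E := by omega
  set σ : ℝ := (Module.finrank ℝ E : ℝ) + 1 with hσdef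
  have hσ : (Module.finrank ℝ E : ℝ) < σ := by simp [hσdef]
  have hσ0 : 0 ≤ σ := by positivity
  have h2σ : 0 ≤ 2 * σ := by positivity
  obtain ⟨At, hAt0, hAt⟩ := exists_collision_tame_bound (E := E) hσ hE2
  obtain ⟨AL, hAL0, hAL⟩ := exists_collision_sub_bound (E := E) hσ hE2
  obtain ⟨V, hV⟩ := exists_vectorField (E := E) hσ hE2
  obtain ⟨Bf, hBf⟩ := schwartz_weighted_bound nin
  have hBf0 : ∀ s, 0 ≤ s → 0 ≤ Bf s := fun s hs => (hBf s hs).1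
  -- generic facts about weighted elements of `E →ᵇ ℝ`
  have hVdec : ∀ (f : E →ᵇ ℝ) (x : E),
      |(1 + ‖x‖) ^ (-(2 * σ)) * f x| ≤ ‖f‖ * (1 + ‖x‖) ^ (-(2 * σ)) := by
    intro f x
    rw [abs_mul, abs_of_pos (wt_pos _ x), mul_comm]
    gcongr
    rw [← Real.norm_eq_abs]
    exact f.norm_coe_le_norm x
  have hVmeas : ∀ f : E →ᵇ ℝ, Measurable fun x => (1 + ‖x‖) ^ (-(2 * σ)) * f x := fun f =>
    ((continuous_wt _).mul f.continuous).measurable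
  -- the initial datum `f₀ = nin / w₀`
  have hf₀c : Continuous fun k : E => ((1 + ‖k‖) ^ (-(2 * σ)))⁻¹ * nin k :=
    ((continuous_wt _).inv₀ fun x => (wt_pos _ x).ne').mul nin.continuous
  have hf₀b : ∀ k : E, ‖((1 + ‖k‖) ^ (-(2 * σ)))⁻¹ * nin k‖ ≤ Bf (2 * σ) := by
    intro k
    rw [Real.norm_eq_abs, abs_mul, abs_inv, abs_of_pos (wt_pos _ k),
      Real.rpow_neg (by positivity), inv_inv]
    exact (hBf (2 * σ) h2σ).2 k
  set f₀ : E →ᵇ ℝ := BoundedContinuousFunction.ofNormedAddCommGroup _ hf₀c _ hf₀b with hf₀def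
  have hf₀ : ∀ k, f₀ k = ((1 + ‖k‖) ^ (-(2 * σ)))⁻¹ * nin k := fun k => rfl
  have hwf₀ : ∀ k, (1 + ‖k‖) ^ (-(2 * σ)) * f₀ k = nin k := fun k => by
    rw [hf₀, ← mul_assoc, mul_inv_cancel₀ (wt_pos _ k).ne', one_mul]
  have hnin_le : ∀ s, 0 ≤ s → ∀ k, |nin k| ≤ Bf s * (1 + ‖k‖) ^ (-s) := by
    intro s hs k
    have hb := (hBf s hs).2 k
    rw [Real.rpow_neg (by positivity), ← div_eq_mul_inv, le_div_iff₀ (by positivity), mul_comm]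
    exact hb
  -- radius, Lipschitz constant, growth bound, time
  set R : ℝ := ‖f₀‖ + 1 with hRdef
  have hR0 : 0 ≤ R := by positivity
  set Λ : ℝ := AL * R ^ 2 with hΛdef
  have hΛ0 : 0 ≤ Λ := by positivity
  set Cg : ℝ := At * 2 ^ (2 * σ) * R ^ 2 * R with hCgdef
  have hCg0 : 0 ≤ Cg := by positivity
  set T : ℝ := 1 / (2 * Λ + 2 * Cg + 2) with hTdef
  have hden : 0 < 2 * Λ + 2 * Cg + 2 := by positivity
  have hT : 0 < T := by positivity
  have hTΛ : T * Λ ≤ 1 / 2 := by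
    rw [hTdef, one_div_mul_eq_div, div_le_iff₀ hden]; linarith
  have hTC : T * Cg ≤ 1 / 2 := by
    rw [hTdef, one_div_mul_eq_div, div_le_iff₀ hden]; linarith
  -- (V1) growth bound
  have hVbound : ∀ f : E →ᵇ ℝ, ‖V f‖ ≤ At * 2 ^ (2 * σ) * ‖f‖ ^ 2 * ‖f‖ := by
    intro f
    refine (BoundedContinuousFunction.norm_le (by positivity)).mpr fun k => ?_
    rw [hV f k, norm_mul, Real.norm_eq_abs, Real.norm_eq_abs, abs_inv, abs_of_pos (wt_pos _ k)]
    have hb := hAt _ ‖f‖ ‖f‖ (2 * σ) k (hVmeas f) (norm_nonneg _) (norm_nonneg _) h2σ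
      (hVdec f) (hVdec f)
    calc ((1 + ‖k‖) ^ (-(2 * σ)))⁻¹ * |collision (fun x => (1 + ‖x‖) ^ (-(2 * σ)) * f x) k|
        ≤ ((1 + ‖k‖) ^ (-(2 * σ)))⁻¹ *
          (At * 2 ^ (2 * σ) * ‖f‖ ^ 2 * ‖f‖ * (1 + ‖k‖) ^ (-(2 * σ))) := by gcongr
      _ = At * 2 ^ (2 * σ) * ‖f‖ ^ 2 * ‖f‖ := by field_simp [(wt_pos (2 * σ) k).ne']
  -- (V2) Lipschitz bound on balls
  have hVlipρ : ∀ (ρ : ℝ), 0 ≤ ρ → ∀ f g : E →ᵇ ℝ, ‖f‖ ≤ ρ → ‖g‖ ≤ ρ →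
      ‖V f - V g‖ ≤ AL * ρ ^ 2 * ‖f - g‖ := by
    intro ρ hρ f g hf hg
    refine (BoundedContinuousFunction.norm_le (by positivity)).mpr fun k => ?_
    have hdf : ∀ x, |(1 + ‖x‖) ^ (-(2 * σ)) * f x| ≤ ρ * (1 + ‖x‖) ^ (-(2 * σ)) := fun x =>
      (hVdec f x).trans (by gcongr)
    have hdg : ∀ x, |(1 + ‖x‖) ^ (-(2 * σ)) * g x| ≤ ρ * (1 + ‖x‖) ^ (-(2 * σ)) := fun x =>
      (hVdec g x).trans (by gcongr)
    have hdfg : ∀ x, |(1 + ‖x‖) ^ (-(2 * σ)) * f x - (1 + ‖x‖) ^ (-(2 * σ)) * g x| ≤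
        ‖f - g‖ * (1 + ‖x‖) ^ (-(2 * σ)) := fun x => by
      rw [← mul_sub]
      exact hVdec (f - g) x
    have hb := hAL _ _ ρ ‖f - g‖ k (hVmeas f) (hVmeas g) hρ (norm_nonneg _) hdf hdg hdfg
    rw [BoundedContinuousFunction.sub_apply, hV f k, hV g k, ← mul_sub, norm_mul,
      Real.norm_eq_abs, Real.norm_eq_abs, abs_inv, abs_of_pos (wt_pos _ k)]
    calc ((1 + ‖k‖) ^ (-(2 * σ)))⁻¹ *
          |collision (fun x => (1 + ‖x‖) ^ (-(2 * σ)) * f x) k -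
            collision (fun x => (1 + ‖x‖) ^ (-(2 * σ)) * g x) k|
        ≤ ((1 + ‖k‖) ^ (-(2 * σ)))⁻¹ * (AL * ρ ^ 2 * ‖f - g‖ * (1 + ‖k‖) ^ (-(2 * σ))) := by
          gcongr
      _ = AL * ρ ^ 2 * ‖f - g‖ := by field_simp [(wt_pos (2 * σ) k).ne']
  have hVlip : ∀ f g : E →ᵇ ℝ, ‖f‖ ≤ R → ‖g‖ ≤ R → ‖V f - V g‖ ≤ Λ * ‖f - g‖ :=
    hVlipρ R hR0
  -- continuity of V
  have hVc : Continuous V := by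
    rw [continuous_iff_continuousAt]
    intro f
    have hL : LipschitzOnWith (Real.toNNReal (AL * (‖f‖ + 1) ^ 2)) V (ball f 1) := by
      refine LipschitzOnWith.of_dist_le_mul fun x hx y hy => ?_
      rw [dist_eq_norm, dist_eq_norm, Real.coe_toNNReal _ (by positivity)]
      have hx' : ‖x‖ ≤ ‖f‖ + 1 := by
        have : ‖x - f‖ < 1 := by rwa [mem_ball, dist_eq_norm] at hx
        calc ‖x‖ = ‖(x - f) + f‖ := by rw [sub_add_cancel]
          _ ≤ ‖x - f‖ + ‖f‖ := norm_add_le _ _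
          _ ≤ ‖f‖ + 1 := by linarith
      have hy' : ‖y‖ ≤ ‖f‖ + 1 := by
        have : ‖y - f‖ < 1 := by rwa [mem_ball, dist_eq_norm] at hy
        calc ‖y‖ = ‖(y - f) + f‖ := by rw [sub_add_cancel]
          _ ≤ ‖y - f‖ + ‖f‖ := norm_add_le _ _
          _ ≤ ‖f‖ + 1 := by linarith
      exact hVlipρ (‖f‖ + 1) (by positivity) x y hx' hy'
    exact hL.continuousOn.continuousAt (ball_mem_nhds f one_pos)
  -- the closed invariant set of curves
  set c : ℝ → ℝ := fun s' => At * 2 ^ s' * R ^ 2 with hcdef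
  have hc0 : ∀ s', 0 ≤ c s' := fun s' => by positivity
  set S : Set (Icc (0 : ℝ) T →ᵇ (E →ᵇ ℝ)) := {γ | (∀ t, ‖γ t‖ ≤ R) ∧
    ∀ s' : ℝ, 2 * σ ≤ s' → ∀ (t : Icc (0 : ℝ) T) (k : E),
      |(1 + ‖k‖) ^ (-(2 * σ)) * γ t k| ≤ Bf s' * Real.exp (c s' * t) * (1 + ‖k‖) ^ (-s')}
    with hSdef
  have hSc : IsClosed S := by
    have h1 : IsClosed {γ : Icc (0 : ℝ) T →ᵇ (E →ᵇ ℝ) | ∀ t, ‖γ t‖ ≤ R} := by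
      simp only [setOf_forall]
      exact isClosed_iInter fun t =>
        isClosed_le (continuous_norm.comp (continuous_eval_const t)) continuous_const
    have h2 : IsClosed {γ : Icc (0 : ℝ) T →ᵇ (E →ᵇ ℝ) | ∀ s' : ℝ, 2 * σ ≤ s' →
        ∀ (t : Icc (0 : ℝ) T) (k : E), |(1 + ‖k‖) ^ (-(2 * σ)) * γ t k| ≤
          Bf s' * Real.exp (c s' * t) * (1 + ‖k‖) ^ (-s')} := by
      simp only [setOf_forall]
      refine isClosed_iInter fun s' => isClosed_iInter fun _ => isClosed_iInter fun t =>
        isClosed_iInter fun k => ?_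
      exact isClosed_le ((continuous_const.mul
        ((continuous_eval_const k).comp (continuous_eval_const t))).abs) continuous_const
    exact h1.inter h2
  have hγ₀ : BoundedContinuousFunction.const (Icc (0 : ℝ) T) f₀ ∈ S := by
    refine ⟨fun t => ?_, fun s' hs' t k => ?_⟩
    · simp only [BoundedContinuousFunction.const_apply, hRdef]
      linarith
    · simp only [BoundedContinuousFunction.const_apply]
      rw [hwf₀]
      have hexp : 1 ≤ Real.exp (c s' * t) := Real.one_le_exp (mul_nonneg (hc0 s') t.2.1)
      calc |nin k| ≤ Bf s' * (1 + ‖k‖) ^ (-s') := hnin_le s' (h2σ.trans hs') k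
        _ = Bf s' * 1 * (1 + ‖k‖) ^ (-s') := by ring
        _ ≤ Bf s' * Real.exp (c s' * t) * (1 + ‖k‖) ^ (-s') := by
            gcongr
            exact hBf0 s' (h2σ.trans hs')
  have hSR : ∀ γ ∈ S, ∀ t, ‖γ t‖ ≤ R := fun γ hγ t => hγ.1 t
  -- invariance of `S` under the Picard map
  have hSP : ∀ γ ∈ S, ∀ γ' : Icc (0 : ℝ) T →ᵇ (E →ᵇ ℝ),
      (∀ t : Icc (0 : ℝ) T, γ' t = f₀ + ∫ τ in (0 : ℝ)..(t : ℝ), V (γ (projIcc 0 T hT.le τ))) →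
        γ' ∈ S := by
    intro γ hγ γ' hγ'
    have hVint : ∀ a b, IntervalIntegrable (fun τ => V (γ (projIcc 0 T hT.le τ))) volume a b :=
      fun a b => ((hVc.comp (γ.continuous.comp continuous_projIcc)).intervalIntegrable a b)
    have hVsup : ∀ τ, ‖V (γ (projIcc 0 T hT.le τ))‖ ≤ Cg := fun τ => by
      refine (hVbound _).trans ?_
      simp only [hCgdef]
      have := hγ.1 (projIcc 0 T hT.le τ)
      gcongr
    constructor
    · intro t
      rw [hγ' t]
      have ht : |(t : ℝ) - 0| ≤ T := by rw [sub_zero, abs_of_nonneg t.2.1]; exact t.2.2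
      calc ‖f₀ + ∫ τ in (0 : ℝ)..(t : ℝ), V (γ (projIcc 0 T hT.le τ))‖
          ≤ ‖f₀‖ + ‖∫ τ in (0 : ℝ)..(t : ℝ), V (γ (projIcc 0 T hT.le τ))‖ := norm_add_le _ _
        _ ≤ ‖f₀‖ + Cg * |(t : ℝ) - 0| := by
            gcongr
            exact intervalIntegral.norm_integral_le_of_norm_le_const fun τ _ => hVsup τ
        _ ≤ ‖f₀‖ + Cg * T := by gcongr
        _ ≤ ‖f₀‖ + 1 := by nlinarith
    · intro s' hs' t k
      have hs'0 : 0 ≤ s' := h2σ.trans hs'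
      have ht0 : (0 : ℝ) ≤ t := t.2.1
      -- evaluate the Picard formula at `k`
      have hev : γ' t k = f₀ k + ∫ τ in (0 : ℝ)..(t : ℝ), V (γ (projIcc 0 T hT.le τ)) k := by
        rw [hγ' t, BoundedContinuousFunction.add_apply]
        congr 1
        have := ((BoundedContinuousFunction.evalCLM ℝ k).intervalIntegral_comp_comm (hVint 0 t))
        simpa only [BoundedContinuousFunction.evalCLM_apply] using this.symm
      -- bound for the integrand
      have hIb : ∀ τ ∈ Ioc (0 : ℝ) t,
          ‖(1 + ‖k‖) ^ (-(2 * σ)) * V (γ (projIcc 0 T hT.le τ)) k‖ ≤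
            c s' * Bf s' * Real.exp (c s' * τ) * (1 + ‖k‖) ^ (-s') := by
        intro τ hτ
        have hτ' : τ ∈ Icc (0 : ℝ) T := ⟨hτ.1.le, hτ.2.trans t.2.2⟩
        have hpτ : ((projIcc 0 T hT.le τ : Icc (0 : ℝ) T) : ℝ) = τ := by
          rw [projIcc_of_mem hT.le hτ']
        have hN₀ : ∀ x, |(1 + ‖x‖) ^ (-(2 * σ)) * γ (projIcc 0 T hT.le τ) x| ≤
            R * (1 + ‖x‖) ^ (-(2 * σ)) := fun x =>
          (hVdec _ x).trans (by gcongr; exact hγ.1 _)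
        have hN' : ∀ x, |(1 + ‖x‖) ^ (-(2 * σ)) * γ (projIcc 0 T hT.le τ) x| ≤
            (Bf s' * Real.exp (c s' * τ)) * (1 + ‖x‖) ^ (-s') := by
          intro x
          have := hγ.2 s' hs' (projIcc 0 T hT.le τ) x
          rwa [hpτ] at this
        have hb := hAt _ R (Bf s' * Real.exp (c s' * τ)) s' k (hVmeas _) hR0
          (mul_nonneg (hBf0 s' hs'0) (Real.exp_nonneg _)) hs'0 hN₀ hN'
        rw [hV _ k, Real.norm_eq_abs, abs_mul, abs_mul, abs_inv, abs_of_pos (wt_pos _ k),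
          ← mul_assoc, mul_inv_cancel₀ (wt_pos _ k).ne', one_mul]
        calc |collision (fun x => (1 + ‖x‖) ^ (-(2 * σ)) * γ (projIcc 0 T hT.le τ) x) k|
            ≤ At * 2 ^ s' * R ^ 2 * (Bf s' * Real.exp (c s' * τ)) * (1 + ‖k‖) ^ (-s') := hb
          _ = c s' * Bf s' * Real.exp (c s' * τ) * (1 + ‖k‖) ^ (-s') := by
              simp only [hcdef]; ring
      -- the integral of the bound
      have hFTC : ∫ τ in (0 : ℝ)..(t : ℝ), c s' * Bf s' * Real.exp (c s' * τ) * (1 + ‖k‖) ^ (-s')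
          = Bf s' * (1 + ‖k‖) ^ (-s') * (Real.exp (c s' * t) - 1) := by
        have hd : ∀ x ∈ uIcc (0 : ℝ) t,
            HasDerivAt (fun τ => Bf s' * (1 + ‖k‖) ^ (-s') * Real.exp (c s' * τ))
              (c s' * Bf s' * Real.exp (c s' * x) * (1 + ‖k‖) ^ (-s')) x := by
          intro x _
          have h1 : HasDerivAt (fun τ : ℝ => c s' * τ) (c s') x := by
            simpa using (hasDerivAt_id' x).const_mul (c s')
          have h3 := h1.exp.const_mul (Bf s' * (1 + ‖k‖) ^ (-s'))
          exact h3.congr_deriv (by ring)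
        rw [intervalIntegral.integral_eq_sub_of_hasDerivAt hd
          ((by fun_prop : Continuous fun τ : ℝ =>
            c s' * Bf s' * Real.exp (c s' * τ) * (1 + ‖k‖) ^ (-s')).intervalIntegrable _ _)]
        simp only [mul_zero, Real.exp_zero]
        ring
      have hinit : |(1 + ‖k‖) ^ (-(2 * σ)) * f₀ k| ≤ Bf s' * (1 + ‖k‖) ^ (-s') := by
        rw [hwf₀]; exact hnin_le s' hs'0 k
      have hint : |∫ τ in (0 : ℝ)..(t : ℝ), (1 + ‖k‖) ^ (-(2 * σ)) * V (γ (projIcc 0 T hT.le τ)) k|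
          ≤ Bf s' * (1 + ‖k‖) ^ (-s') * (Real.exp (c s' * t) - 1) := by
        rw [← Real.norm_eq_abs, ← hFTC]
        refine intervalIntegral.norm_integral_le_of_norm_le ht0
          (Eventually.of_forall hIb) ?_
        exact (by fun_prop : Continuous fun τ : ℝ =>
          c s' * Bf s' * Real.exp (c s' * τ) * (1 + ‖k‖) ^ (-s')).intervalIntegrable _ _
      rw [hev, mul_add, ← intervalIntegral.integral_const_mul]
      calc |(1 + ‖k‖) ^ (-(2 * σ)) * f₀ k +
            ∫ τ in (0 : ℝ)..(t : ℝ), (1 + ‖k‖) ^ (-(2 * σ)) * V (γ (projIcc 0 T hT.le τ)) k|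
          ≤ |(1 + ‖k‖) ^ (-(2 * σ)) * f₀ k| +
            |∫ τ in (0 : ℝ)..(t : ℝ), (1 + ‖k‖) ^ (-(2 * σ)) * V (γ (projIcc 0 T hT.le τ)) k| :=
            abs_add_le _ _
        _ ≤ Bf s' * (1 + ‖k‖) ^ (-s') + Bf s' * (1 + ‖k‖) ^ (-s') * (Real.exp (c s' * t) - 1) :=
            add_le_add hinit hint
        _ = Bf s' * Real.exp (c s' * t) * (1 + ‖k‖) ^ (-s') := by ring
  -- the fixed point
  obtain ⟨γ, hγS, hγ0, hγd⟩ := exists_picard_fixedPoint V f₀ hT hΛ0 hVc hVlip hTΛ S hSc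
    ⟨_, hγ₀⟩ hSR hSP
  set sol : ℝ → (E →ᵇ ℝ) := fun s => γ (projIcc 0 T hT.le s) with hsol
  refine ⟨T, hT, fun t k => (1 + ‖k‖) ^ (-(2 * σ)) * sol t k, ?_, ?_, ?_⟩
  · -- initial datum
    funext k
    simp only [hsol]
    rw [hγ0, hwf₀]
  · -- classical solution on [0, T)
    intro k
    constructor
    · exact (continuous_const.mul ((continuous_eval_const k).comp
        (γ.continuous.comp continuous_projIcc))).continuousOn
    · intro t ht
      have htI : t ∈ Icc (0 : ℝ) T := Ico_subset_Icc_self ht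
      constructor
      · exact wkeIntegrable_of_decay hσ hE2 (hVmeas (sol t)) (norm_nonneg (sol t))
          (hVdec (sol t)) k
      · have hd := hγd t htI
        have hd2 : HasDerivWithinAt (fun s => sol s k) (V (sol t) k) (Icc 0 T) t := by
          have := (BoundedContinuousFunction.evalCLM ℝ k).hasFDerivAt.comp_hasDerivWithinAt t hd
          simpa only [BoundedContinuousFunction.evalCLM_apply, Function.comp_def] using this
        have hd3 := hd2.const_mul ((1 + ‖k‖) ^ (-(2 * σ)))
        have hval : (1 + ‖k‖) ^ (-(2 * σ)) * V (sol t) k =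
            collision (fun x => (1 + ‖x‖) ^ (-(2 * σ)) * sol t x) k := by
          rw [hV, ← mul_assoc, mul_inv_cancel₀ (wt_pos _ k).ne', one_mul]
        rw [hval] at hd3
        exact hd3.mono_of_mem_nhdsWithin (Icc_mem_nhdsGE_of_mem ht)
  · -- decay of every order, uniformly on [0, T)
    intro s
    by_cases hs : s ≤ 2 * σ
    · refine ⟨R, fun t ht k => ?_⟩
      calc |(1 + ‖k‖) ^ (-(2 * σ)) * sol t k| ≤ ‖sol t‖ * (1 + ‖k‖) ^ (-(2 * σ)) := hVdec _ k
        _ ≤ R * (1 + ‖k‖) ^ (-s) :=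
            mul_le_mul (hSR γ hγS _) (wt_anti_exp hs k) (wt_pos _ _).le hR0
    · have hs' : 2 * σ < s := lt_of_not_ge hs
      refine ⟨Bf s * Real.exp (c s * T), fun t ht k => ?_⟩
      have htI : t ∈ Icc (0 : ℝ) T := Ico_subset_Icc_self ht
      have hb := hγS.2 s hs'.le ⟨t, htI⟩ k
      have hst : sol t = γ ⟨t, htI⟩ := by
        simp only [hsol, projIcc_of_mem hT.le htI]
      show |(1 + ‖k‖) ^ (-(2 * σ)) * sol t k| ≤ _
      rw [hst]
      refine hb.trans ?_
      have hexp : Real.exp (c s * t) ≤ Real.exp (c s * T) :=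
        Real.exp_le_exp.mpr (mul_le_mul_of_nonneg_left ht.2.le (hc0 s))
      have := hBf0 s (by linarith)
      gcongr

end LocalExistence

end WaveKinetic

end

end Literature.Analysis.FluidPDE
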